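/-
Copyright (c) 2026. All rights reserved.
Released under Apache 2.0 license as described in the file LICENSE.
Authors: abc-iut cell, F fact-proving wave seat abc-iut-f-073 (tranche 73).
-/
import Literature.AnabelianGeometry.AbsoluteAnabelian.AbsTopIII.BiAnabelianObservableProofs
import Literature.AnabelianGeometry.AbsoluteAnabelian.AbsTopIII.BiAnabelianModelProofs
import Literature.AnabelianGeometry.AbsoluteAnabelian.AbsTopIII.BiAnabelianTelecoreSchemaNegative

/-!
# [AbsTopIII] Cor 3.7 (iii)/(iv) as typed — kernel verdicts on the three SCHEMA rows
# `LogPinned` (F-0320), `IncompatibleStmt` (F-0319), `LogKernelObstruction` (F-0322)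

S. Mochizuki, *Topics in absolute anabelian geometry III* [MochizukiAbsTopIII2015] (kurims manuscript
`paper:url-5493eb38cbb7`; journal pagination not held), Cor 3.7 (iii), (iv) p. 88 (Cor 3.7 starts
p. 86); Lemma 3.4 p. 74.  PROOF-ONLY companion of `BiAnabelianIncompatibility.lean` /
`BiAnabelianIncompatibilityProofs.lean` (abc-iut-L4-t9): no notion is declared, nothing is restated,
no `def` at all — the degenerate witnesses against the universal closures live inside proofs.

All three rows are SCHEMATA over an ABSTRACT input `𝔖 : BiAnabelianSetting X E N` (Cor 3.7's rows
`≤ 4` with `T = T𝔽` left abstract: three categories, functors `gal, log, λ^×, λ^{×pf}, 𝒩 → 𝔈`,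
natural transformations `ι_log, ι_×`; plan/FOUNDATIONS row 12: the étale-`π₁` instance is not in the
tree); `LogPinned` is moreover a predicate on a family of homotopies `H` on `𝒟†_{≤3}`.  FACT-LIST rule
R5: the universal closure of a schema row is not a fact — instance forms at named instances are.
Kernel verdicts filed here:

* F-0320 `LogPinned` — INSTANCE FORM PROVED for every setting: `logPinned_obsFamily`, i.e. "`ι_{log,⋎}`
  (respectively, `ι_×`) determine(s) the homotopies for pairs of type (1) (respectively, (2))" holds
  for THE family `obsFamily` of the Cor 3.7 (iii) discharge (`BiAnabelianObservableProofs.lean`);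
  UNIVERSAL CLOSURE REFUTED: `not_forall_logPinned` (for every setting the family with empty boundary
  set — abc-iut-f-074's `exists_homotopyFamily_empty`, `BiAnabelianTelecoreSchemaNegative.lean` —
  pins nothing, `exists_not_logPinned`).
* F-0322 `LogKernelObstruction` — UNIVERSAL CLOSURE REFUTED: `not_forall_logKernelObstruction` (no
  setting on TERMINAL carriers `𝒳 = 𝔈 = 𝒩 = Discrete PUnit` has the obstruction: every
  `λ^×(a) ≫ ι_{log,x₀}` equals `ι_{×,x₀}`, all parallel morphisms being equal —
  `not_logKernelObstruction_of_terminal`; such a setting exists, `nonempty_setting_terminal`: all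
  functors `𝟭`, all 2-cells identities; abc-iut-f-074's `exists_thin_allPinned` records the same
  failure at its thin setting inside an existential); INSTANCE FORM PROVED in the tree, cited:
  `exists_logKernelObstruction` (abc-iut-L4-t9's `TFModel.modelSetting_logKernelObstruction`, the MLF
  model on `ℚ̄_p`, Lemma 3.4: `ι_×(p) = [p] ∉ (𝒪^×_k̄)^pf`; further instances in the tree:
  `modelSettingSlim_logKernelObstruction`, `TFModel.model_of_logKernelObstruction`).
* F-0319 `IncompatibleStmt` — UNIVERSAL CLOSURE REFUTED: `not_forall_incompatibleStmt` (on `𝒟†_{≤3}`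
  of a setting on terminal carriers every hom-set is a singleton, so there is a SYMMETRIC family of
  homotopies whose boundary set is ALL co-verticial pairs — `exists_homotopyFamily_total`, the unique
  natural transformation as homotopy; it contains isomorphisms `ζ₀` for the would-be core pairs
  `([pr_{⋎+1}], [pr_⋎]∘[log_𝒳])` AND the pinned `𝔖†_log` homotopies —
  `not_incompatibleStmt_of_terminal`); INSTANCE FORM PROVED in the tree, cited:
  `exists_incompatibleStmt` (`TFModel.model_incompatibleStmt`; also `model_slim_incompatibleStmt`).
* `*_schema_verdict` — both conjuncts per row, the form the FACT-LIST label «universal-closure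
  REFUTED; instance form PROVED» describes.

HONEST FRAMING: statements about the cell's own typing of refereed pre-IUT material over abstract
data; the printed Cor 3.7 concerns the specific MLF data (where (iv) is the model theorems cited) and
is neither refuted nor newly proved here; nothing here bears on [IUTchIII] Cor. 3.12 or takes a side;
typed ≠ proved.
-/

set_option autoImplicit false

namespace Literature.AnabelianGeometry.AbsoluteAnabelian

open _root_.CategoryTheory _root_.Quiver

universe v u w

/-! ## The total family of homotopies on a diagram with singleton hom-sets (witness tool; the EMPTY
family is abc-iut-f-074's `DiagramOfCategories.exists_homotopyFamily_empty`, imported) -/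

namespace DiagramOfCategories

variable {V : Type w} [Quiver.{v} V] (D : DiagramOfCategories.{v, u, w} V)

/-- On a diagram of categories ALL of whose vertex categories have singleton hom-sets there is a
SYMMETRIC family of homotopies whose boundary set is the set of ALL co-verticial pairs (`covert`,
symmetrically saturated, §0 p. 26): the homotopy of a pair is the unique natural transformation
between its two path functors, and the axioms of Def 3.5 (ii) hold because all parallel morphisms
agree.  (All its homotopies are isomorphisms, `HomotopyFamily.isIso_of_isSymmetric`.)
[cite: MochizukiAbsTopIII2015, Definition 3.5 (ii) p.75] -/
theorem exists_homotopyFamily_total (hs : ∀ (b : V) (x y : D.obj b), Subsingleton (x ⟶ y))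
    (hn : ∀ (b : V) (x y : D.obj b), Nonempty (x ⟶ y)) :
    ∃ H : D.HomotopyFamily, H.IsSymmetric ∧ ∀ ⦃a b : V⦄ (p q : Path a b), H.E p q := by
  classical
  exact
    ⟨{ E := covert
       isSaturated := isSymmSaturated_covert.toIsSaturated
       η := fun _ b _ _ _ =>
        { app := fun x => (hn b _ _).some
          naturality := fun _ _ _ => (hs b _ _).elim _ _ }
       η_refl := fun _ b _ _ => by ext x; exact (hs b _ _).elim _ _
       η_trans := fun _ b _ _ _ _ _ => by ext x; exact (hs b _ _).elim _ _
       η_whisker := fun _ _ _ d _ _ _ _ _ => by ext x; exact (hs d _ _).elim _ _ },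
      isSymmSaturated_covert, fun _ _ _ _ => trivial⟩

end DiagramOfCategories

namespace AbsTopIII

open DiagramOfCategories

namespace BiAnabelianSetting

/-! ## F-0320 `LogPinned`: instance form PROVED (every setting); universal closure refuted -/

section Instance

variable {X E N : Type u} [Category.{u} X] [Category.{u} E] [Category.{u} N]
  (𝔖 : BiAnabelianSetting X E N)

/-- **F-0320, instance form PROVED (every bi-anabelian setting)**: the family of homotopies `𝔖†_log`
constructed in the Cor 3.7 (iii) discharge (`obsFamily`, `BiAnabelianObservableProofs.lean`) is
`LogPinned` — it contains the type-(2) pair `([λ^×], [λ^{×pf}])` with homotopy `ι_×` and, for every `⋎`,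
the type-(1) pair `([λ^×]∘[pr_⋎]∘[log_𝒳], [λ^{×pf}]∘[pr_{⋎+1}])` with homotopy `ι_{log,⋎}` ("`ι_{log,⋎}`
(respectively, `ι_×`) determine(s) the homotopies for pairs of type (1) (respectively, (2))").  This is
the instance at which the predicate is consumed (`ObservableLogStmt`); same computation as
`observableLogStmt_holds`. [cite: MochizukiAbsTopIII2015, Cor 3.7 (iii) p.88] -/
theorem logPinned_obsFamily :
    Literature.AnabelianGeometry.AbsoluteAnabelian.AbsTopIII.BiAnabelianSetting.LogPinned 𝔖
      𝔖.obsFamily := by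
  refine ⟨⟨ObsRel.mk (ObsCell.times Path.nil), fun x e₁ e₂ => ?_⟩, fun n => ?_⟩
  · rw [obsFamily_η, 𝔖.obsEta_eq (p := timesPairLeft.{u}) (q := timesPairRight.{u}) _
      (ObsCell.times Path.nil) rfl rfl]
    simp only [cellT, cell, NatTrans.comp_app, eqToHom_app, Functor.whiskerLeft_app, eqToHom_trans,
      eqToHom_trans_assoc, Category.assoc]
    rfl
  · refine ⟨ObsRel.mk (ObsCell.log n Path.nil), fun o e₁ e₂ => ?_⟩
    rw [obsFamily_η, 𝔖.obsEta_eq (p := logPairLeft.{u} n) (q := logPairRight.{u} n) _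
      (ObsCell.log n Path.nil) rfl rfl]
    simp only [cellT, cell, NatTrans.comp_app, eqToHom_app, Functor.whiskerLeft_app, eqToHom_trans,
      eqToHom_trans_assoc, Category.assoc]
    rfl

/-- **F-0320, the printed existence form**: the typed Cor 3.7 (iii) (`ObservableLogStmt`, discharged
for every setting) yields in particular SOME family on `𝒟†_{≤3}` that is `LogPinned`.
[cite: MochizukiAbsTopIII2015, Cor 3.7 (iii) p.88] -/
theorem exists_logPinned :
    ∃ H : 𝔖.logObsDiagram.HomotopyFamily,
      Literature.AnabelianGeometry.AbsoluteAnabelian.AbsTopIII.BiAnabelianSetting.LogPinned 𝔖 H :=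
  ⟨𝔖.obsFamily, 𝔖.logPinned_obsFamily⟩

/-- For EVERY setting some family of homotopies on `𝒟†_{≤3}` is NOT `LogPinned` — the one with empty
boundary set does not contain the pair `([λ^×], [λ^{×pf}])`: `LogPinned` is a genuine CONDITION on the
family (vocabulary of Cor 3.7 (iii)), not a fact. [cite: MochizukiAbsTopIII2015, Cor 3.7 (iii) p.88] -/
theorem exists_not_logPinned :
    ∃ H : 𝔖.logObsDiagram.HomotopyFamily,
      ¬ Literature.AnabelianGeometry.AbsoluteAnabelian.AbsTopIII.BiAnabelianSetting.LogPinned 𝔖 H := by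
  obtain ⟨H, hH⟩ := 𝔖.logObsDiagram.exists_homotopyFamily_empty
  exact ⟨H, fun hp => hp.1.elim fun h _ => hH _ _ h⟩

end Instance

/-! ## Settings on TERMINAL carriers (kernel witnesses against the universal closures) -/

section Terminal

/-- Hom-sets of the terminal category are subsingletons — the Mathlib instance, recorded as a lemma so
that it can be invoked at the vertex categories of `𝒟†_{≤3}` of a setting on terminal carriers, which
ARE the terminal category but only up to unfolding of the diagram. [folklore] -/
private theorem subsingleton_hom_discretePUnit (x y : Discrete PUnit.{u + 1}) :
    Subsingleton (x ⟶ y) :=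
  inferInstance

/-- Hom-sets of the terminal category are inhabited. [folklore] -/
private theorem nonempty_hom_discretePUnit (x y : Discrete PUnit.{u + 1}) : Nonempty (x ⟶ y) :=
  ⟨eqToHom (Subsingleton.elim x y)⟩

variable (𝔖 : BiAnabelianSetting (Discrete PUnit.{u + 1}) (Discrete PUnit.{u + 1})
  (Discrete PUnit.{u + 1}))

/-- For a setting on terminal carriers `𝒳 = 𝔈 = 𝒩 = Discrete PUnit`, every hom-set of every vertex
category of `𝒟†_{≤3}` (`𝒳 ×_𝔈 𝒳`, `𝒳`, `𝒩`) has at most one element.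
[cite: MochizukiAbsTopIII2015, Cor 3.7 (iii) p.88] -/
theorem hom_subsingleton_of_terminal :
    ∀ (b : logObsShape.{u}.Vertex) (x y : 𝔖.logObsDiagram.obj b), Subsingleton (x ⟶ y)
  | .obs, x, y => subsingleton_hom_discretePUnit x y
  | .base ⟨.first _, _⟩, _, _ =>
    ⟨fun _ _ => Limits.CategoricalPullback.hom_ext (Subsingleton.elim _ _) (Subsingleton.elim _ _)⟩
  | .base ⟨.box, _⟩, x, y => subsingleton_hom_discretePUnit x y
  | .base ⟨.space, _⟩, x, y => subsingleton_hom_discretePUnit x y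
  | .base ⟨.galois, _⟩, x, y => subsingleton_hom_discretePUnit x y
  | .base ⟨.ref, _⟩, x, y => subsingleton_hom_discretePUnit x y

/-- For a setting on terminal carriers, every hom-set of every vertex category of `𝒟†_{≤3}` is
inhabited. [cite: MochizukiAbsTopIII2015, Cor 3.7 (iii) p.88] -/
theorem hom_nonempty_of_terminal :
    ∀ (b : logObsShape.{u}.Vertex) (x y : 𝔖.logObsDiagram.obj b), Nonempty (x ⟶ y)
  | .obs, x, y => nonempty_hom_discretePUnit x y
  | .base ⟨.first _, _⟩, _, _ =>
    ⟨{ fst := eqToHom (Subsingleton.elim _ _)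
       snd := eqToHom (Subsingleton.elim _ _)
       w := Subsingleton.elim _ _ }⟩
  | .base ⟨.box, _⟩, x, y => nonempty_hom_discretePUnit x y
  | .base ⟨.space, _⟩, x, y => nonempty_hom_discretePUnit x y
  | .base ⟨.galois, _⟩, x, y => nonempty_hom_discretePUnit x y
  | .base ⟨.ref, _⟩, x, y => nonempty_hom_discretePUnit x y

/-- **No setting on terminal carriers has the Lemma-3.4 obstruction**: for every `x₀` the (unique)
isomorphism `a : x₀ ⥲ log x₀` has `λ^×(a) ≫ ι_{log,x₀} = ι_{×,x₀}`, both sides being the unique morphism.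
[cite: MochizukiAbsTopIII2015, Lemma 3.4 p.74] -/
theorem not_logKernelObstruction_of_terminal :
    ¬ Literature.AnabelianGeometry.AbsoluteAnabelian.AbsTopIII.BiAnabelianSetting.LogKernelObstruction
        𝔖 := by
  rintro ⟨x₀, hx₀⟩
  exact hx₀ (eqToHom (Subsingleton.elim _ _)) inferInstance (Subsingleton.elim _ _)

/-- **No setting on terminal carriers satisfies the typed first incompatibility of Cor 3.7 (iv)**: the
total family of homotopies on `𝒟†_{≤3}` (`exists_homotopyFamily_total`) contains an ISOMORPHISM for
every would-be core pair `([pr_{⋎+1}], [pr_⋎]∘[log_𝒳])` (homotopies of a symmetric family are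
invertible) and is `LogPinned` (all parallel morphisms of `𝒩` agree).
[cite: MochizukiAbsTopIII2015, Cor 3.7 (iv) p.88] -/
theorem not_incompatibleStmt_of_terminal :
    ¬ Literature.AnabelianGeometry.AbsoluteAnabelian.AbsTopIII.BiAnabelianSetting.IncompatibleStmt
        𝔖 := by
  intro h
  obtain ⟨K, hKs, hKE⟩ := 𝔖.logObsDiagram.exists_homotopyFamily_total
    𝔖.hom_subsingleton_of_terminal 𝔖.hom_nonempty_of_terminal
  exact h ⟨K,
    fun n => ⟨hKE _ _, HomotopyFamily.isIso_of_isSymmetric 𝔖.logObsDiagram K hKs (hKE _ _)⟩,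
    ⟨hKE _ _, fun x e₁ e₂ => (𝔖.hom_subsingleton_of_terminal _ _ _).elim _ _⟩,
    fun n => ⟨hKE _ _, fun o e₁ e₂ => (𝔖.hom_subsingleton_of_terminal _ _ _).elim _ _⟩⟩

/-- **A setting on terminal carriers exists**: all functors `𝟭`, `log ≅ 𝟭`, `ι_log`, `ι_×` and the
Galois 2-cells identities — legitimate data of the abstract input structure, which records only the
SHAPE of rows `≤ 4` of Cor 3.7's diagram (a kernel witness, not a model of MLF-Galois pairs).
[cite: MochizukiAbsTopIII2015, Cor 3.7 p.86] -/
theorem nonempty_setting_terminal :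
    Nonempty (BiAnabelianSetting (Discrete PUnit.{u + 1}) (Discrete PUnit.{u + 1})
      (Discrete PUnit.{u + 1})) :=
  ⟨{ gal := 𝟭 _
     log := 𝟭 _
     logIsoId := Iso.refl _
     lamTimes := 𝟭 _
     lamTimesPf := 𝟭 _
     iotaLog := (Functor.leftUnitor (𝟭 _)).hom
     iotaTimes := 𝟙 _
     spaceGal := 𝟭 _
     lamTimesGal := Functor.leftUnitor (𝟭 _)
     lamTimesPfGal := Functor.leftUnitor (𝟭 _) }⟩

end Terminal

/-! ## The universal closures REFUTED; instance forms cited; verdicts -/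

/-- **F-0322, universal closure REFUTED.**  `LogKernelObstruction` as typed is a genuine HYPOTHESIS on
the setting (R5): it fails at every setting on terminal carriers, and one exists.  (For the MLF model
it is the THEOREM `TFModel.modelSetting_logKernelObstruction`, Lemma 3.4.)
[cite: MochizukiAbsTopIII2015, Lemma 3.4 p.74] -/
theorem not_forall_logKernelObstruction :
    ¬ ∀ (X E N : Type u) [Category.{u} X] [Category.{u} E] [Category.{u} N]
        (𝔖 : BiAnabelianSetting X E N),
        Literature.AnabelianGeometry.AbsoluteAnabelian.AbsTopIII.BiAnabelianSetting.LogKernelObstruction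
          𝔖 :=
  fun h => nonempty_setting_terminal.{u}.elim fun 𝔖 =>
    not_logKernelObstruction_of_terminal 𝔖 (h _ _ _ 𝔖)

/-- **F-0322, instance form PROVED (cited)**: the schema is inhabited at the MLF model of abc-iut-L4-t9
— `TFModel.modelSetting_logKernelObstruction` (model `TF`-pairs on `ℚ̄_p`, here `p = 2`; at the
mono-analytic object `(G_{ℚ_p} ↷ ℚ̄_p)`, `ι_×(p) = [p] ∉ (𝒪^×_k̄)^pf`, Lemma 3.4).
[cite: MochizukiAbsTopIII2015, Lemma 3.4 p.74] -/
theorem exists_logKernelObstruction :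
    ∃ (X E N : Type 1) (_ : Category.{1} X) (_ : Category.{1} E) (_ : Category.{1} N)
      (𝔖 : BiAnabelianSetting X E N),
      Literature.AnabelianGeometry.AbsoluteAnabelian.AbsTopIII.BiAnabelianSetting.LogKernelObstruction
        𝔖 := by
  haveI : Fact (Nat.Prime 2) := ⟨Nat.prime_two⟩
  exact ⟨_, _, _, _, _, _, TFModel.modelSetting 2, TFModel.modelSetting_logKernelObstruction 2⟩

/-- **F-0322, kernel verdict on the schema row** `LogKernelObstruction`: universal closure refuted AND
inhabited at a named instance proved in the tree. [cite: MochizukiAbsTopIII2015, Lemma 3.4 p.74] -/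
theorem logKernelObstruction_schema_verdict :
    (¬ ∀ (X E N : Type u) [Category.{u} X] [Category.{u} E] [Category.{u} N]
        (𝔖 : BiAnabelianSetting X E N),
        Literature.AnabelianGeometry.AbsoluteAnabelian.AbsTopIII.BiAnabelianSetting.LogKernelObstruction
          𝔖) ∧
      ∃ (X E N : Type 1) (_ : Category.{1} X) (_ : Category.{1} E) (_ : Category.{1} N)
        (𝔖 : BiAnabelianSetting X E N),
        Literature.AnabelianGeometry.AbsoluteAnabelian.AbsTopIII.BiAnabelianSetting.LogKernelObstruction
          𝔖 :=
  ⟨not_forall_logKernelObstruction.{u}, exists_logKernelObstruction⟩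

/-- **F-0319, universal closure REFUTED.**  `IncompatibleStmt` as typed is a genuine HYPOTHESIS on the
setting (R5): it fails at every setting on terminal carriers, and one exists.  (For the MLF model it is
the THEOREM `TFModel.model_incompatibleStmt`; for every setting it follows from
`LogKernelObstruction` by `incompatibleStmt_of_obstruction`.)
[cite: MochizukiAbsTopIII2015, Cor 3.7 (iv) p.88] -/
theorem not_forall_incompatibleStmt :
    ¬ ∀ (X E N : Type u) [Category.{u} X] [Category.{u} E] [Category.{u} N]
        (𝔖 : BiAnabelianSetting X E N),
        Literature.AnabelianGeometry.AbsoluteAnabelian.AbsTopIII.BiAnabelianSetting.IncompatibleStmt 𝔖 :=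
  fun h => nonempty_setting_terminal.{u}.elim fun 𝔖 =>
    not_incompatibleStmt_of_terminal 𝔖 (h _ _ _ 𝔖)

/-- **F-0319, instance form PROVED (cited)**: the schema is inhabited at the MLF model of abc-iut-L4-t9
— `TFModel.model_incompatibleStmt` (Cor 3.7 (iv), first incompatibility, UNCONDITIONAL at the model
`TF`-pairs on `ℚ̄_p`, here `p = 2`). [cite: MochizukiAbsTopIII2015, Cor 3.7 (iv) p.88] -/
theorem exists_incompatibleStmt :
    ∃ (X E N : Type 1) (_ : Category.{1} X) (_ : Category.{1} E) (_ : Category.{1} N)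
      (𝔖 : BiAnabelianSetting X E N),
      Literature.AnabelianGeometry.AbsoluteAnabelian.AbsTopIII.BiAnabelianSetting.IncompatibleStmt 𝔖 := by
  haveI : Fact (Nat.Prime 2) := ⟨Nat.prime_two⟩
  exact ⟨_, _, _, _, _, _, TFModel.modelSetting 2, TFModel.model_incompatibleStmt 2⟩

/-- **F-0319, kernel verdict on the schema row** `IncompatibleStmt`: universal closure refuted AND
inhabited at a named instance proved in the tree. [cite: MochizukiAbsTopIII2015, Cor 3.7 (iv) p.88] -/
theorem incompatibleStmt_schema_verdict :
    (¬ ∀ (X E N : Type u) [Category.{u} X] [Category.{u} E] [Category.{u} N]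
        (𝔖 : BiAnabelianSetting X E N),
        Literature.AnabelianGeometry.AbsoluteAnabelian.AbsTopIII.BiAnabelianSetting.IncompatibleStmt 𝔖) ∧
      ∃ (X E N : Type 1) (_ : Category.{1} X) (_ : Category.{1} E) (_ : Category.{1} N)
        (𝔖 : BiAnabelianSetting X E N),
        Literature.AnabelianGeometry.AbsoluteAnabelian.AbsTopIII.BiAnabelianSetting.IncompatibleStmt 𝔖 :=
  ⟨not_forall_incompatibleStmt.{u}, exists_incompatibleStmt⟩

/-- **F-0320, universal closure REFUTED.**  `LogPinned` is a genuine CONDITION on the family `H` (R5;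
vocabulary of Cor 3.7 (iii)): at any setting (one exists on terminal carriers) the family with empty
boundary set violates it.  Its instance form is `logPinned_obsFamily` (every setting).
[cite: MochizukiAbsTopIII2015, Cor 3.7 (iii) p.88] -/
theorem not_forall_logPinned :
    ¬ ∀ (X E N : Type u) [Category.{u} X] [Category.{u} E] [Category.{u} N]
        (𝔖 : BiAnabelianSetting X E N) (H : 𝔖.logObsDiagram.HomotopyFamily),
        Literature.AnabelianGeometry.AbsoluteAnabelian.AbsTopIII.BiAnabelianSetting.LogPinned 𝔖 H :=
  fun h => nonempty_setting_terminal.{u}.elim fun 𝔖 =>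
    (exists_not_logPinned 𝔖).elim fun H hH => hH (h _ _ _ 𝔖 H)

/-- **F-0320, kernel verdict on the schema row** `LogPinned`: universal closure refuted AND the instance
form proved for every setting at the family of the Cor 3.7 (iii) discharge.
[cite: MochizukiAbsTopIII2015, Cor 3.7 (iii) p.88] -/
theorem logPinned_schema_verdict :
    (¬ ∀ (X E N : Type u) [Category.{u} X] [Category.{u} E] [Category.{u} N]
        (𝔖 : BiAnabelianSetting X E N) (H : 𝔖.logObsDiagram.HomotopyFamily),
        Literature.AnabelianGeometry.AbsoluteAnabelian.AbsTopIII.BiAnabelianSetting.LogPinned 𝔖 H) ∧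
      ∀ (X E N : Type u) [Category.{u} X] [Category.{u} E] [Category.{u} N]
        (𝔖 : BiAnabelianSetting X E N),
        Literature.AnabelianGeometry.AbsoluteAnabelian.AbsTopIII.BiAnabelianSetting.LogPinned 𝔖
          𝔖.obsFamily :=
  ⟨not_forall_logPinned.{u}, fun _ _ _ _ _ _ 𝔖 => 𝔖.logPinned_obsFamily⟩

end BiAnabelianSetting

end AbsTopIII

end Literature.AnabelianGeometry.AbsoluteAnabelian
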